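import Mathlib
import HarnessLib
import Summits.ABC.ABC.Theses.CongruentialReceptacle
import Summits.ABC.ABC.Theorems.CompactBalanceTransfer.Negative.StrengthSzpiroToAbc

/-!
# Crux `CompactBalanceTransfer` (stmt-ABC-1725) — currency split and quality-preserving balancing

Structure lemmas for the crux `CompactBalanceTransfer := H → ABC` of route CongruentialReceptacle, where
`H := ∀ κ > 0, ∀ ε > 0, ∃ C, ∀ abc-triples, κc ≤ a → κc ≤ b → c < C · rad(abc)^(1+ε)` (abc on every compactly
balanced cell). They are §1–§2 of the crux-strategist's workfile `Cruxes/CompactBalanceTransfer/StrategySplit.lean`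
(seat `planner-cstrat-stmt-ABC-1725-0`, 2026-08-16, rc 0 / 0 sorries there), landed VERBATIM under `Theorems` by the
line lead `prover-line-stmt-ABC-1725-a1-0` (Theorems is prover-only) so that the tenure planner's route-level
options R1/R2 of `Cruxes/CompactBalanceTransfer/STRATEGY-CENSUS.md` §6 have importable glue:

* §1 CURRENCY SPLIT (census D1). With `F := ∀ ε > 0, ∃ C, ∀ abc-triples, (abc)² ≤ C · rad(abc)^(6+ε)` (Szpiro `6+ε`
  for the Frey curves of ALL triples in the route's elementary currency = Oesterlé's forme forte):
  `compactBalanceTransfer_of_subs : (H → F) → (F → ABC) → CompactBalanceTransfer` (shape `C₁ → C₂ → C` for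
  `ledger route edit --split CompactBalanceTransfer … --glue-by Summit.ABC.ABC.Theorems.compactBalanceTransfer_of_subs`)
  and the exactness check `compactBalanceTransfer_iff_subs : CompactBalanceTransfer ↔ (H → F) ∧ (F → ABC)`.
* §2 QUALITY-PRESERVING BALANCING (census S1): `compactBalanceTransfer_of_qualityBalancing` — if every abc-triple has
  a quarter-balanced shadow of comparable logarithmic height whose radical exceeds the scaled radical by at most
  `c^δ` (every `δ > 0`), then the crux holds, and the proof USES `H` (at `κ = 1/4`) on the shadow: the one line shape
  on record in which `H` is load-bearing and no stub restates `ABC` (contrast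
  `Theorems/CompactBalanceTransfer/Negative/DepthCellDissolution.lean`: every depth-cell complement of `H` is the summit).

No `def`s; unconditional; standard axioms; no named facts.
-/

-- `Summit.<Summit>.<Problem>`: for the single-conjunct summit `ABC` the duplicate `ABC.ABC` is mandated.
set_option linter.dupNamespace false

namespace Summit.ABC.ABC.Theorems

open Literature.NumberTheory.DiophantineGeometry
open Summit.ABC.ABC.Theses.CongruentialReceptacle

/-! ## §1 Currency split: `crux ↔ (H → F) ∧ (F → ABC)` -/

/-- **Glue of the currency split (D1).** If balanced abc gives Szpiro `6+ε` for all Frey curves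
(`H → F`, the archimedean transfer with factor-3 slack) and Szpiro for all Frey curves gives abc
(`F → ABC`, Oesterlé's open implication), then `CompactBalanceTransfer`. Shape `C₁ → C₂ → C` for
`ledger route edit --split CompactBalanceTransfer --glue-by`. [folklore] -/
theorem compactBalanceTransfer_of_subs :
    ((∀ κ : ℝ, 0 < κ → ∀ ε : ℝ, 0 < ε → ∃ C : ℝ, ∀ a b c : ℕ, IsABCTriple a b c →
        κ * (c : ℝ) ≤ (a : ℝ) → κ * (c : ℝ) ≤ (b : ℝ) →
          (c : ℝ) < C * ((rad a b c : ℕ) : ℝ) ^ (1 + ε)) →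
      (∀ ε : ℝ, 0 < ε → ∃ C : ℝ, ∀ a b c : ℕ, IsABCTriple a b c →
        ((a * b * c : ℕ) : ℝ) ^ 2 ≤ C * ((rad a b c : ℕ) : ℝ) ^ (6 + ε))) →
    ((∀ ε : ℝ, 0 < ε → ∃ C : ℝ, ∀ a b c : ℕ, IsABCTriple a b c →
        ((a * b * c : ℕ) : ℝ) ^ 2 ≤ C * ((rad a b c : ℕ) : ℝ) ^ (6 + ε)) → _root_.ABC) →
    CompactBalanceTransfer :=
  fun h₁ h₂ hH => h₂ (h₁ hH)

/-- `ABC` gives Szpiro `6 + ε` for the Frey curves of all abc-triples in elementary currency: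
`(abc)² ≤ c⁶ < C⁶ · rad^(6+ε)` from `c < C · rad^(1+ε/6)`. [folklore] -/
theorem freySzpiroAll_of_abc (hA : _root_.ABC) :
    ∀ ε : ℝ, 0 < ε → ∃ C : ℝ, ∀ a b c : ℕ, IsABCTriple a b c →
      ((a * b * c : ℕ) : ℝ) ^ 2 ≤ C * ((rad a b c : ℕ) : ℝ) ^ (6 + ε) := by
  intro ε hε
  obtain ⟨C₀, hC₀pos, hC₀⟩ := (_root_.ABC_iff.mp hA) (ε / 6) (by positivity)
  refine ⟨C₀ ^ 6, fun a b c habc => ?_⟩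
  have hlt := hC₀ a b c habc
  obtain ⟨ha0, hb0, hsum, _⟩ := habc
  set X : ℝ := ((rad a b c : ℕ) : ℝ) ^ (1 + ε / 6) with hX
  have hR0 : (0 : ℝ) ≤ ((rad a b c : ℕ) : ℝ) := Nat.cast_nonneg _
  have hX0 : 0 ≤ X := Real.rpow_nonneg hR0 _
  have hc0 : (0 : ℝ) ≤ (c : ℝ) := Nat.cast_nonneg _
  have hcle : (c : ℝ) ≤ C₀ * X := le_of_lt hlt
  have hale : a ≤ c := by omega
  have hble : b ≤ c := by omega
  have habc_le : ((a * b * c : ℕ) : ℝ) ≤ (c : ℝ) ^ 3 := by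
    have : a * b * c ≤ c * c * c := by gcongr
    calc ((a * b * c : ℕ) : ℝ) ≤ ((c * c * c : ℕ) : ℝ) := by exact_mod_cast this
      _ = (c : ℝ) ^ 3 := by push_cast; ring
  have h0abc : (0 : ℝ) ≤ ((a * b * c : ℕ) : ℝ) := Nat.cast_nonneg _
  have hsq : ((a * b * c : ℕ) : ℝ) ^ 2 ≤ ((c : ℝ) ^ 3) ^ 2 := pow_le_pow_left₀ h0abc habc_le 2
  have hpow6 : (c : ℝ) ^ 6 ≤ (C₀ * X) ^ 6 := pow_le_pow_left₀ hc0 hcle 6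
  have hX6 : X ^ 6 = ((rad a b c : ℕ) : ℝ) ^ (6 + ε) := by
    rw [hX, ← Real.rpow_natCast, ← Real.rpow_mul hR0]
    norm_num
    ring_nf
  calc ((a * b * c : ℕ) : ℝ) ^ 2 ≤ ((c : ℝ) ^ 3) ^ 2 := hsq
    _ = (c : ℝ) ^ 6 := by ring
    _ ≤ (C₀ * X) ^ 6 := hpow6
    _ = C₀ ^ 6 * X ^ 6 := by ring
    _ = C₀ ^ 6 * ((rad a b c : ℕ) : ℝ) ^ (6 + ε) := by rw [hX6]

/-- **The currency split is exact (D1).** `CompactBalanceTransfer ↔ (H → F) ∧ (F → ABC)` with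
`F` = Szpiro `6+ε` for all Frey curves in elementary currency: `→` uses that under `H` the crux is `ABC`
(hence `F` by `freySzpiroAll_of_abc`, and `F → ABC` by the tree's strength certificate
`abc_of_freySzpiro_of_compactBalanceTransfer`); `←` is `compactBalanceTransfer_of_subs`. So the two
pieces are each implied by the crux and jointly equivalent to it — neither is a rewording: the first
keeps the hypothesis and weakens the conclusion to exponent-3 currency, the second is balance-free.
[folklore] -/
theorem compactBalanceTransfer_iff_subs :
    CompactBalanceTransfer ↔
      (((∀ κ : ℝ, 0 < κ → ∀ ε : ℝ, 0 < ε → ∃ C : ℝ, ∀ a b c : ℕ, IsABCTriple a b c →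
          κ * (c : ℝ) ≤ (a : ℝ) → κ * (c : ℝ) ≤ (b : ℝ) →
            (c : ℝ) < C * ((rad a b c : ℕ) : ℝ) ^ (1 + ε)) →
        (∀ ε : ℝ, 0 < ε → ∃ C : ℝ, ∀ a b c : ℕ, IsABCTriple a b c →
          ((a * b * c : ℕ) : ℝ) ^ 2 ≤ C * ((rad a b c : ℕ) : ℝ) ^ (6 + ε))) ∧
       ((∀ ε : ℝ, 0 < ε → ∃ C : ℝ, ∀ a b c : ℕ, IsABCTriple a b c →
          ((a * b * c : ℕ) : ℝ) ^ 2 ≤ C * ((rad a b c : ℕ) : ℝ) ^ (6 + ε)) → _root_.ABC)) := by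
  constructor
  · intro hT
    exact ⟨fun hH => freySzpiroAll_of_abc (hT hH),
      fun hF => Summit.ABC.ABC.Theorems.CompactBalanceTransfer.Negative.abc_of_freySzpiro_of_compactBalanceTransfer hF hT⟩
  · rintro ⟨h₁, h₂⟩
    exact compactBalanceTransfer_of_subs h₁ h₂

/-! ## §2 Quality-preserving balancing implies the crux (and uses `H`) -/

/-- **Quality-preserving balancing gives the crux.** Suppose that for every `δ > 0` there is `B` such that
every abc-triple `(a,b,c)` admits a quarter-balanced abc-triple `(a',b',c')` and a real `λ ≥ 1` with
`λ·log c − B ≤ log c'` and `log rad(a'b'c') ≤ λ·log rad(abc) + δ·log c + B` (a balanced "shadow" of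
comparable logarithmic height whose radical exceeds the scaled radical by at most `c^δ`). Then abc on the
quarter-balanced cell (the instance `κ = 1/4` of `H`) transfers to all triples: `CompactBalanceTransfer`.
Proof: apply `H(1/4, ε/2)` to the shadow and take logarithms; with `θ := (1+ε/2)/(1+ε)` and
`δ := (1−θ)/(1+ε/2)` the two shadow inequalities give `θ·log c < K + (1+ε/2)·log rad(abc)` with `K`
depending on `ε` only, i.e. `c < e^{K(1+ε)/(1+ε/2)} · rad(abc)^(1+ε)`. [folklore] -/
theorem compactBalanceTransfer_of_qualityBalancing
    (hQB : ∀ δ : ℝ, 0 < δ → ∃ B : ℝ, ∀ a b c : ℕ, IsABCTriple a b c →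
      ∃ a' b' c' : ℕ, IsABCTriple a' b' c' ∧ (1 / 4 : ℝ) * (c' : ℝ) ≤ (a' : ℝ) ∧
        (1 / 4 : ℝ) * (c' : ℝ) ≤ (b' : ℝ) ∧
        ∃ l : ℝ, 1 ≤ l ∧ l * Real.log c - B ≤ Real.log c' ∧
          Real.log ((rad a' b' c' : ℕ) : ℝ) ≤ l * Real.log ((rad a b c : ℕ) : ℝ) + δ * Real.log c + B) :
    CompactBalanceTransfer := by
  intro hH
  rw [_root_.ABC_iff]
  intro ε hε
  -- constants: ε₁ = ε/2, θ = (1+ε₁)/(1+ε) ∈ (0,1), δ = (1−θ)/(1+ε₁) > 0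
  have h1ε : (0 : ℝ) < 1 + ε := by positivity
  obtain ⟨ε₁, hε₁⟩ : ∃ ε₁ : ℝ, ε₁ = ε / 2 := ⟨_, rfl⟩
  have hε₁pos : 0 < ε₁ := by rw [hε₁]; positivity
  have h1ε₁ : (0 : ℝ) < 1 + ε₁ := by positivity
  have h1ε₁ne : (1 + ε₁ : ℝ) ≠ 0 := h1ε₁.ne'
  have h1εne : (1 + ε : ℝ) ≠ 0 := h1ε.ne'
  obtain ⟨θ, hθ⟩ : ∃ θ : ℝ, θ = (1 + ε₁) / (1 + ε) := ⟨_, rfl⟩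
  have hθpos : 0 < θ := by rw [hθ]; positivity
  have hθlt : θ < 1 := by
    rw [hθ, div_lt_one h1ε, hε₁]; linarith
  have hθmul : θ * (1 + ε) = 1 + ε₁ := by rw [hθ]; field_simp
  obtain ⟨δ, hδ⟩ : ∃ δ : ℝ, δ = (1 - θ) / (1 + ε₁) := ⟨_, rfl⟩
  have hδpos : 0 < δ := by rw [hδ]; exact div_pos (by linarith) h1ε₁
  have hδθ : (1 + ε₁) * δ = 1 - θ := by rw [hδ]; field_simp
  have hθeq : θ = 1 - (1 + ε₁) * δ := by linarith
  obtain ⟨C₁, hC₁⟩ := hH (1 / 4) (by norm_num) ε₁ hε₁pos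
  obtain ⟨B, hB⟩ := hQB δ hδpos
  -- normalised constants C₁' ≥ 1, B' ≥ 0, K ≥ 0
  have hC₁'one : (1 : ℝ) ≤ max C₁ 1 := le_max_right _ _
  have hC₁'pos : (0 : ℝ) < max C₁ 1 := lt_of_lt_of_le one_pos hC₁'one
  have hB'nn : (0 : ℝ) ≤ max B 0 := le_max_right _ _
  have hBB' : B ≤ max B 0 := le_max_left _ _
  have hlogC : 0 ≤ Real.log (max C₁ 1) := Real.log_nonneg hC₁'one
  obtain ⟨K, hK⟩ : ∃ K : ℝ, K = Real.log (max C₁ 1) + max B 0 + (1 + ε₁) * max B 0 := ⟨_, rfl⟩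
  have hKnn : 0 ≤ K := by rw [hK]; positivity
  refine ⟨Real.exp (K * (1 + ε) / (1 + ε₁)), Real.exp_pos _, ?_⟩
  intro a b c habc
  obtain ⟨a', b', c', habc', ha', hb', l, hl1, hlow, hrad⟩ := hB a b c habc
  -- positivity of the data
  have hcpos : (0 : ℝ) < c := by
    obtain ⟨ha0, _, hsum, _⟩ := habc
    exact_mod_cast (show 0 < c by omega)
  have hc1 : (1 : ℝ) ≤ c := by
    obtain ⟨ha0, _, hsum, _⟩ := habc
    exact_mod_cast (show 1 ≤ c by omega)
  have hc'pos : (0 : ℝ) < c' := by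
    obtain ⟨ha0, _, hsum, _⟩ := habc'
    exact_mod_cast (show 0 < c' by omega)
  have hlogc : 0 ≤ Real.log c := Real.log_nonneg hc1
  have hRpos : (0 : ℝ) < ((rad a b c : ℕ) : ℝ) := by
    have h0 : 0 < rad a b c := by
      rw [rad_def]
      exact Nat.pos_of_ne_zero UniqueFactorizationMonoid.radical_ne_zero
    exact_mod_cast h0
  have hR1 : (1 : ℝ) ≤ ((rad a b c : ℕ) : ℝ) := by
    have h0 : 0 < rad a b c := by
      rw [rad_def]
      exact Nat.pos_of_ne_zero UniqueFactorizationMonoid.radical_ne_zero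
    exact_mod_cast h0
  have hlogR : 0 ≤ Real.log ((rad a b c : ℕ) : ℝ) := Real.log_nonneg hR1
  have hR'pos : (0 : ℝ) < ((rad a' b' c' : ℕ) : ℝ) := by
    have h0 : 0 < rad a' b' c' := by
      rw [rad_def]
      exact Nat.pos_of_ne_zero UniqueFactorizationMonoid.radical_ne_zero
    exact_mod_cast h0
  -- `H` on the shadow, in logarithms
  have h1 := hC₁ a' b' c' habc' ha' hb'
  have hXnn : 0 ≤ ((rad a' b' c' : ℕ) : ℝ) ^ (1 + ε₁) := Real.rpow_nonneg hR'pos.le _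
  have hXpos : 0 < ((rad a' b' c' : ℕ) : ℝ) ^ (1 + ε₁) := Real.rpow_pos_of_pos hR'pos _
  have h1' : (c' : ℝ) < max C₁ 1 * ((rad a' b' c' : ℕ) : ℝ) ^ (1 + ε₁) :=
    lt_of_lt_of_le h1 (mul_le_mul_of_nonneg_right (le_max_left _ _) hXnn)
  have h2 : Real.log c' < Real.log (max C₁ 1) + (1 + ε₁) * Real.log ((rad a' b' c' : ℕ) : ℝ) := by
    have := Real.log_lt_log hc'pos h1'
    rwa [Real.log_mul (ne_of_gt hC₁'pos) (ne_of_gt hXpos), Real.log_rpow hR'pos] at this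
  -- the two shadow inequalities with `max B 0`
  have h3 : l * Real.log c - max B 0 ≤ Real.log c' := by linarith
  have h4 : Real.log ((rad a' b' c' : ℕ) : ℝ) ≤
      l * Real.log ((rad a b c : ℕ) : ℝ) + δ * Real.log c + max B 0 := by linarith
  have h4' : (1 + ε₁) * Real.log ((rad a' b' c' : ℕ) : ℝ) ≤
      (1 + ε₁) * (l * Real.log ((rad a b c : ℕ) : ℝ) + δ * Real.log c + max B 0) :=
    mul_le_mul_of_nonneg_left h4 h1ε₁.le
  -- combine: `l·log c − (1+ε₁)δ·log c < K + (1+ε₁)·l·log rad`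
  have h5 : l * Real.log c - (1 + ε₁) * δ * Real.log c <
      K + (1 + ε₁) * (l * Real.log ((rad a b c : ℕ) : ℝ)) := by
    rw [hK]; linarith [h2, h3, h4']
  -- use `l ≥ 1`
  have hlpos : 0 < l := by linarith
  have e2 : (1 + ε₁) * δ * Real.log c ≤ l * ((1 + ε₁) * δ * Real.log c) :=
    le_mul_of_one_le_left (mul_nonneg (mul_nonneg h1ε₁.le hδpos.le) hlogc) hl1
  have e3 : K ≤ l * K := le_mul_of_one_le_left hKnn hl1
  have h6 : l * (θ * Real.log c) < l * (K + (1 + ε₁) * Real.log ((rad a b c : ℕ) : ℝ)) :=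
    calc l * (θ * Real.log c) = l * Real.log c - l * ((1 + ε₁) * δ * Real.log c) := by
          rw [hθeq]; ring
      _ ≤ l * Real.log c - (1 + ε₁) * δ * Real.log c := by linarith [e2]
      _ < K + (1 + ε₁) * (l * Real.log ((rad a b c : ℕ) : ℝ)) := h5
      _ ≤ l * K + (1 + ε₁) * (l * Real.log ((rad a b c : ℕ) : ℝ)) := by linarith [e3]
      _ = l * (K + (1 + ε₁) * Real.log ((rad a b c : ℕ) : ℝ)) := by ring
  have h7 : θ * Real.log c < K + (1 + ε₁) * Real.log ((rad a b c : ℕ) : ℝ) :=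
    lt_of_mul_lt_mul_left h6 hlpos.le
  -- divide by `θ = (1+ε₁)/(1+ε)`: `log c < K(1+ε)/(1+ε₁) + (1+ε)·log rad`
  have h8 : Real.log c < K * (1 + ε) / (1 + ε₁) + (1 + ε) * Real.log ((rad a b c : ℕ) : ℝ) := by
    have hmul := mul_lt_mul_of_pos_right h7 h1ε
    have lhs : θ * Real.log c * (1 + ε) = (1 + ε₁) * Real.log c := by
      rw [mul_comm θ, mul_assoc, hθmul]; ring
    rw [lhs] at hmul
    have hdiv := div_lt_div_of_pos_right hmul h1ε₁
    have e1 : (1 + ε₁) * Real.log c / (1 + ε₁) = Real.log c := by field_simp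
    have e4 : (K + (1 + ε₁) * Real.log ((rad a b c : ℕ) : ℝ)) * (1 + ε) / (1 + ε₁) =
        K * (1 + ε) / (1 + ε₁) + (1 + ε) * Real.log ((rad a b c : ℕ) : ℝ) := by
      field_simp
    rwa [e1, e4] at hdiv
  -- exponentiate
  calc (c : ℝ) = Real.exp (Real.log c) := (Real.exp_log hcpos).symm
    _ < Real.exp (K * (1 + ε) / (1 + ε₁) + (1 + ε) * Real.log ((rad a b c : ℕ) : ℝ)) :=
        Real.exp_lt_exp.mpr h8
    _ = Real.exp (K * (1 + ε) / (1 + ε₁)) * ((rad a b c : ℕ) : ℝ) ^ (1 + ε) := by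
        rw [Real.exp_add, Real.rpow_def_of_pos hRpos, mul_comm (Real.log _) (1 + ε)]

end Summit.ABC.ABC.Theorems
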